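import Mathlib

/-!
# Far derivative estimate for a normalised holomorphic map near infinity

For `f : ℂ → ℂ` complex differentiable outside a disc and normalised by `f η - η → 0` at
infinity, Cauchy's estimate for `h := f - id` on the disc of radius `‖η‖ / 2` centred at `η`
(on which `‖h‖ ≤ 1/8` once `‖η‖` is large) gives `‖deriv f η - 1‖ ≤ 1/8 < 1/2`.
-/

set_option linter.dupNamespace false

noncomputable section

open Filter Set Metric
open scoped Topology

namespace Summit.SmoothPoincare4.SmoothPoincare4.Cruxes.TameOrBrodyR4.Sketch

namespace FarDeriv

/-- From `f η - η → 0` along `cocompact ℂ`, a radius beyond which `‖f η - η‖ < 1/8`. -/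
theorem exists_radius_small (f : ℂ → ℂ)
    (hnorm : Tendsto (fun η => f η - η) (cocompact ℂ) (𝓝 0)) :
    ∃ ρ₂ : ℝ, ∀ η : ℂ, ρ₂ ≤ ‖η‖ → ‖f η - η‖ < 1 / 8 := by
  have h1 : ∀ᶠ η in cocompact ℂ, ‖f η - η‖ < 1 / 8 := by
    have := (Metric.tendsto_nhds.1 hnorm) (1 / 8) (by norm_num)
    simpa only [dist_zero_right] using this
  rw [← Metric.cobounded_eq_cocompact, ← comap_norm_atTop, eventually_comap] at h1
  obtain ⟨r, hr⟩ := eventually_atTop.1 h1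
  exact ⟨r, fun v hv => hr _ hv _ rfl⟩

/-- Points of the closed disc of radius `‖η‖ / 2` about `η` have norm at least `‖η‖ / 2`. -/
theorem half_norm_le_of_mem_closedBall (η ζ : ℂ) (hζ : ζ ∈ closedBall η (‖η‖ / 2)) :
    ‖η‖ / 2 ≤ ‖ζ‖ := by
  rw [mem_closedBall, dist_eq_norm] at hζ
  have h1 : ‖η‖ - ‖ζ‖ ≤ ‖η - ζ‖ := norm_sub_norm_le η ζ
  rw [norm_sub_rev] at h1
  linarith

end FarDeriv

open FarDeriv in
/-- **Far derivative estimate.** If `f : ℂ → ℂ` is complex differentiable on `{ρ₁ ≤ ‖η‖}` and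
`f η - η → 0` at infinity, then there is `ρ₀ ≥ ρ₁`, `ρ₀ > 0`, with `‖deriv f η - 1‖ < 1/2`
whenever `ρ₀ ≤ ‖η‖`. Proof: Cauchy's estimate for `h := f - id` on the disc of radius
`‖η‖ / 2` centred at `η`, on which `h` is holomorphic with `‖h‖ ≤ 1/8`. -/
theorem helper_farDeriv (f : ℂ → ℂ) (ρ₁ : ℝ)
    (hhol : ∀ η : ℂ, ρ₁ ≤ ‖η‖ → DifferentiableAt ℂ f η)
    (hnorm : Tendsto (fun η => f η - η) (cocompact ℂ) (𝓝 0)) :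
    ∃ ρ₀ : ℝ, ρ₁ ≤ ρ₀ ∧ 0 < ρ₀ ∧ ∀ η : ℂ, ρ₀ ≤ ‖η‖ → ‖deriv f η - 1‖ < 1 / 2 := by
  obtain ⟨ρ₂, hρ₂⟩ := exists_radius_small f hnorm
  obtain ⟨ρ₀, hρ₀a, hρ₀2⟩ : ∃ ρ₀ : ℝ, 2 * max ρ₂ ρ₁ ≤ ρ₀ ∧ 2 ≤ ρ₀ :=
    ⟨max (2 * max ρ₂ ρ₁) 2, le_max_left _ _, le_max_right _ _⟩
  have hm₁ : ρ₁ ≤ max ρ₂ ρ₁ := le_max_right _ _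
  have hm₂ : ρ₂ ≤ max ρ₂ ρ₁ := le_max_left _ _
  refine ⟨ρ₀, ?_, by linarith, ?_⟩
  · rcases le_or_gt 0 ρ₁ with h | h
    · linarith
    · linarith
  intro η hη
  -- the radius of the Cauchy disc
  have hr : 0 < ‖η‖ / 2 := by linarith
  have hr1 : 1 ≤ ‖η‖ / 2 := by linarith
  -- every point of the closed disc is far out
  have hfar : ∀ ζ ∈ closedBall η (‖η‖ / 2), max ρ₂ ρ₁ ≤ ‖ζ‖ := by
    intro ζ hζ
    have h2 := half_norm_le_of_mem_closedBall η ζ hζ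
    linarith
  have hdiff : DifferentiableOn ℂ (fun ζ => f ζ - ζ) (closedBall η (‖η‖ / 2)) := by
    intro ζ hζ
    have hf : DifferentiableAt ℂ f ζ := hhol ζ (hm₁.trans (hfar ζ hζ))
    exact (hf.sub differentiableAt_id).differentiableWithinAt
  have hdc : DiffContOnCl ℂ (fun ζ => f ζ - ζ) (ball η (‖η‖ / 2)) :=
    hdiff.diffContOnCl_ball Subset.rfl
  have hC : ∀ z ∈ sphere η (‖η‖ / 2), ‖f z - z‖ ≤ 1 / 8 := fun z hz =>
    (hρ₂ z (hm₂.trans (hfar z (sphere_subset_closedBall hz)))).le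
  have hest := Complex.norm_deriv_le_of_forall_mem_sphere_norm_le hr hdc hC
  -- `deriv (f - id) η = deriv f η - 1`
  have hfη : DifferentiableAt ℂ f η := hhol η (hm₁.trans (hfar η (mem_closedBall_self hr.le)))
  have hderiv : deriv (fun ζ => f ζ - ζ) η = deriv f η - 1 :=
    (hfη.hasDerivAt.sub (hasDerivAt_id' η)).deriv
  rw [← hderiv]
  calc ‖deriv (fun ζ => f ζ - ζ) η‖ ≤ 1 / 8 / (‖η‖ / 2) := hest
    _ ≤ 1 / 8 := div_le_self (by norm_num) hr1
    _ < 1 / 2 := by norm_num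

end Summit.SmoothPoincare4.SmoothPoincare4.Cruxes.TameOrBrodyR4.Sketch
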